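import Summits.CriticalPhenomena.SAWScalingLimit.Theses.SAWRenewalTightness
import Summits.CriticalPhenomena.SAWScalingLimit.Theorems.SAWRenewalTightnessEventualTightConfinementRatioMono
import Summits.CriticalPhenomena.SAWScalingLimit.Theorems.SAWRenewalTightnessConfinementPositivityRademacherTube
import Summits.CriticalPhenomena.SAWScalingLimit.Theorems.SAWRenewalTightnessConfinementPositivityStandardPair
import Summits.CriticalPhenomena.SAWScalingLimit.Theorems.SAWRenewalTightnessConfinementPositivityUnpinnedSlabTube
import Summits.CriticalPhenomena.SAWScalingLimit.Theorems.SAWRenewalTightnessConfinementPositivityExtentOfExpTail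
import Summits.CriticalPhenomena.SAWScalingLimit.Theorems.SAWRenewalTightnessConfinementPositivitySlabOfChain
import Summits.CriticalPhenomena.SAWScalingLimit.Theorems.SAWRenewalTightnessConfinementPositivityPinnedDenominator
import Summits.CriticalPhenomena.SAWScalingLimit.Theorems.SAWRenewalTightnessConfinementPositivityPinnedNumerator
import Summits.CriticalPhenomena.SAWScalingLimit.Theorems.SAWRenewalTightnessConfinementPositivityPinnedAssembly
import Summits.CriticalPhenomena.SAWScalingLimit.Theorems.SAWRenewalTightnessConfinementPositivitySlabPairTwoSided
import Literature.Probability.RandomPlanarGeometry.SAWWordBridges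
import Literature.Probability.RandomPlanarGeometry.SAWCount
import HarnessLib

/-!
# Crux `ConfinementPositivity` (stmt-CriticalPhenomena-17587) — line `Sketch` (card `sign-universality`),
# lead skeleton v4.2 (continuation lead prover-line-stmt-CriticalPhenomena-17587-c2-0, cycle 3 — TERMINAL; v4.1 by lead -c1, cycle 2)

History.  v1 (lead -0): R1 R2 U A B T.  v2 (lead -0): U2 S P B′p J, with B′u (`Theorems.stub_unpinnedSlabTube`, p151705)
and T2 (`Theorems.stub_standardPairReduction`, p149604) landed.  v3 (this lead): UE `stub_extentSecondMoment_of_expTail`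
LANDED p154815 (U2 is implied by the first conjunct of P) and B′p0 `stub_slabOfChain` LANDED p156756 (+ word lemmas p156169:
Kesten's unique factorisation as a bijection chains ↔ bridge words ↔ slab walks).

What v4 changes (typing verdict of the B′p1 worker, `work/stubs/Bp1-report-c2.md`, attached as evidence; `LeadAnalysis-c2.md`):

* The pinning layer B′p1 `UnpinnedSlabTube → (UAT-exp ∧ AR) → ChainPinnedTube` was `stub-misstated` on two counts.
  (i) Its conclusion contained a STEEP CORNER (`L + 1 ≪ W`, `|y₁ − y₀| ≈ W`) that no registered primitive reaches (an
  exact-DP chain model satisfying everything registered has pinned tube ratio `0.92 → 10⁻⁴` as `W/(L+1) = 1 → 16` at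
  `W = 32`); the junction only ever consumes boxes of bounded aspect, so every pinned/slab statement is now TWO-SIDED
  (`L ≤ αW ∧ W ≤ α(L+1)`).  (ii) Exact pinning of the end height is a LOWER bound at resolution 1 and has no handle in
  UAT-exp/AR (ceilings); the clean repair is one lower one-piece primitive LR `HeightLocalRichness` (exact atom `≥ c/s` at
  every height `|h| ≤ As`, overshoot `≤ s/D`, spans `s ≥ s₀(A,D)`: span-2 irreducible bridges NEVER have `|H| ≤ 1`, exact
  enumeration to length 25) and one span-law ceiling USP `SmallPiecesCeiling` (chains of span `n` all of whose pieces are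
  `< n/K` carry `≤ C/K²` of the mass).  With them the layer has a two-page ONE-CUT proof that uses neither flip symmetry
  nor an LCLT, split here into three PROVABLE stubs:
  Den `stub_pinnedDenominator : AR → USP → PinnedAtomCeiling` (the end height of a chain of span `n` has atoms
  `≤ C' u_n / n`: cut at the first piece of span `≥ n/(2^{j+1})`, AR on that piece, USP on the dyadic dust classes),
  Num `stub_pinnedNumerator : UnpinnedSlabTube → LR → USP → PinnedTubeFloor` (pinned W-tube mass `≥ c u_n / n` for
  `W ≥ W₀(α)`: B′u-prefix in the tube `W/8` + one LR steering piece of span `≥ n/K` + B′u-suffix, multiplicity `≤ K`,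
  `R_K ≥ u_n/2` by USP), Asm `stub_pinnedAssembly : PinnedAtomCeiling → PinnedTubeFloor → SlabTubeConfinement'`
  (ratio `c/C'`; finite part `W < W₀` by the explicit monotone chain `[E·N^Δ, E, …, E]`; chain → slab currency by the
  landed `SlabOfChain.chain_eq_ofReal_slab`).
* Primitives are bundled by kind: P `stub_pinningPrimitives` = UAT-exp ∧ AR (unchanged, OPEN), R `stub_regularityPrimitives`
  = S `SmallPiecesFloor` ∧ USP `SmallPiecesCeiling` ∧ LR `HeightLocalRichness` (OPEN; S is the former `stub_smallPiecesFloor`).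
* J becomes `stub_junction2 : SlabTubeConfinement' → StandardPairConfinement` (two-sided input; OPEN and crux-sized: the
  passage from slab/box pairs — where every walk of the outer domain is a bridge — to general Dobrushin pairs).

Stubs after wave 3 (Den LANDED p160861, Num LANDED p163106 + p162560 + p162926, Asm LANDED p163906): the ONLY `sorry`s left
are the three OPEN stubs P `stub_pinningPrimitives` (UAT-exp ∧ AR), R `stub_regularityPrimitives` (S ∧ USP ∧ LR) — five named
primitives of Kesten's irreducible-bridge measure, all of RSW-for-critical-SAW type — and J2 `stub_junction2` (crux-sized).
The lattice core `SlabTubeConfinement'` (two-sided RSW for critical SAW bridges in slabs) is PROVED modulo P and R: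
`slabTubeConfinement'_holds` below is kernel-closed but for those two hypotheses.
Composition: `ConfinementPositivity_of hP hR hJ := Theorems.stub_standardPairReduction (hJ (Theorems.stub_pinnedAssembly
  (Theorems.stub_pinnedDenominator hP.2 hR.2.1) (Theorems.stub_pinnedNumerator (Theorems.stub_unpinnedSlabTube
  (Theorems.stub_extentSecondMoment_of_expTail hP.1) hR.1) hR.2.2 hR.2.1)))` — three OPEN hypotheses, six landed theorems inside.

v4.2 (lead -c2, cycle 3).  Composition and the three OPEN stubs P, R, J2 are UNCHANGED (re-registered 2026-08-17T14:47Z).  Landed this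
cycle: the two-sided slab-pair transfer `Theorems.stub_slabPairReduction2 : SlabTubeConfinement' → SlabPairConfinement` and the
composite `Theorems.boxPairConfinement_of_kestenPrimitives : P → R → SlabPairConfinement` (p167861,
`Theorems/…ConfinementPositivitySlabPairTwoSided.lean`) — the crux RESTRICTED TO BOX PAIRS (outer `(0,L)×(-V,V)`, inner
`(0,L)×(-W,W)`, marked points `0, L`, extremal-column endpoint approximations) modulo the five primitives; re-exported below as
`slabPairConfinement_holds` (kernel-closed but for P, R).  Terminal audit of the residue (`Lines/Sketch.dead.md`): P = UAT-exp ∧ AR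
and R = S ∧ USP ∧ LR are open statements about Kesten's irreducible-bridge measure with no tool in print on ℤ² (even the coarser
`u_T → 0` with a rate is open on ℤ², KrachunPanagiotis2026 p. 2; hexagonal only, via the parafermion), AR/LR are resolution-1 LOCAL
statements not implied by the summit `SAWScalingLimit`; J2 hides the un-bridging of the general-domain denominator (Hammersley–Welsh
loss `e^{C√n}`), i.e. the crux's own obstacle.  No repair inside the line exists: verdict `line-dead` (L5, third clause), the
skeleton and the 22 landed files stay as `--supports` evidence.
-/

noncomputable section
open scoped BigOperators ENNReal Topology
open Classical
open Literature.Probability.RandomPlanarGeometry Literature.Probability.RandomPlanarGeometry.SAW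
open Literature.Probability.LatticeModels
open Summit.CriticalPhenomena.SAWScalingLimit.Theses.SAWRenewalTightness (ConfinementPositivity)

namespace Summit.CriticalPhenomena.SAWScalingLimit.Cruxes.ConfinementPositivity.SignUniversality

/-! ### Objects -/

/-- Vertical extent `E(w) = max_{i ≤ |w|} |y_i|` of a word (relative to its start). -/
def yExtent (w : List Step) : ℕ :=
  (Finset.range (w.length + 1)).sup fun i => (traj w i 1).natAbs

/-- Critical mass (`ℝ≥0∞`) of the irreducible bridge words of span `s`, weighted by `F`. -/
def irrSpanMass (s : ℕ) (F : List Step → ℝ≥0∞) : ℝ≥0∞ :=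
  ∑' w : {w : List Step // IsIrrBridge w},
    if xEnd w.1 = (s : ℤ) then F w.1 * ENNReal.ofReal (criticalFugacity ^ w.1.length) else 0

/-- Critical mass (`ℝ≥0∞`) of Kesten chains (lists of irreducible bridge words) of total span `L` satisfying `Q`;
by Kesten's unique factorisation these are the self-avoiding bridges of span `L` (tree: `renewal_append_bijective`). -/
def chainSpanMass (L : ℕ) (Q : List (List Step) → Prop) : ℝ≥0∞ :=
  ∑' l : {l : List (List Step) // (∀ w ∈ l, IsIrrBridge w) ∧ (l.map xEnd).sum = (L : ℤ) ∧ Q l},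
    ENNReal.ofReal (criticalFugacity ^ (l.1.map List.length).sum)

/-- Partial `x_c`-mass (lengths `≤ N`) of SAWs from `(0, y₀)` to `(L, y₁)` staying in the box
`0 ≤ x ≤ L`, `|y| ≤ W` (vertex functions, lattice units). -/
def slabTubeMass (L W : ℕ) (y₀ y₁ : ℤ) (N : ℕ) : ℝ :=
  ∑ n ∈ Finset.range (N + 1),
    ∑ _ω ∈ (Zd.sawFun 2 n ![(L : ℤ), y₁ - y₀]).filter
        (fun ω => ∀ i ≤ n, (0 : ℤ) ≤ ω i 0 ∧ ω i 0 ≤ (L : ℤ) ∧ |y₀ + ω i 1| ≤ (W : ℤ)),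
      criticalFugacity ^ n

/-! ### Statements -/

/-- U2: conditional second moment of the extent of one irreducible bridge, `E_K[ext² | span s] ≤ C s²` (OPEN). -/
def ExtentSecondMoment : Prop :=
  ∃ C : ℝ, 0 < C ∧ ∀ s : ℕ, 1 ≤ s →
    irrSpanMass s (fun w => ((yExtent w : ℕ) : ℝ≥0∞) ^ 2) ≤ ENNReal.ofReal (C * (s : ℝ) ^ 2) * irrSpanMass s (fun _ => 1)

/-- S: small-pieces floor — among Kesten chains of total span `L ≤ aW`, those all of whose pieces have span `≤ W/b`
carry a fraction `≥ q(a,b) > 0` of the critical mass (OPEN span-law regularity; fails for lacunary laws). -/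
def SmallPiecesFloor : Prop :=
  ∀ a b : ℕ, 1 ≤ a → 1 ≤ b → ∃ q : ℝ, 0 < q ∧ ∀ W L : ℕ, b ≤ W → L ≤ a * W →
    ENNReal.ofReal q * chainSpanMass L (fun _ => True) ≤
      chainSpanMass L (fun l => ∀ w ∈ l, (b : ℤ) * xEnd w ≤ (W : ℤ))

/-- Unpinned slab tube: Kesten chains of total span `L ≤ aW` whose concatenation stays in the tube `|y| ≤ W` carry a
fraction `≥ c(a) > 0` of the critical mass of all chains of span `L`. -/
def UnpinnedSlabTube : Prop :=
  ∀ a : ℕ, 1 ≤ a → ∃ c : ℝ, 0 < c ∧ ∀ W L : ℕ, 1 ≤ W → L ≤ a * W →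
    ENNReal.ofReal c * chainSpanMass L (fun _ => True) ≤
      chainSpanMass L (fun l => ∀ i, |traj l.flatten i 1| ≤ (W : ℤ))

/-- UAT-exp: exponential conditional tail of the extent given the span (OPEN pinning input). -/
def ExtentExpTail : Prop :=
  ∃ C : ℝ, 0 < C ∧ ∀ s t : ℕ, 1 ≤ s → 1 ≤ t →
    (∑' w : {w : List Step // IsIrrBridge w},
        {w : {w : List Step // IsIrrBridge w} | xEnd w.1 = s ∧
            t * s ≤ (Finset.range (w.1.length + 1)).sup fun i => (traj w.1 i 1).natAbs}.indicator
          (fun w => criticalFugacity ^ w.1.length) w) ≤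
      C * Real.exp (-(t : ℝ) / C) * ∑' w : {w : List Step // IsIrrBridge w},
        {w : {w : List Step // IsIrrBridge w} | xEnd w.1 = s}.indicator
          (fun w => criticalFugacity ^ w.1.length) w

/-- AR: height anti-concentration of one irreducible bridge (OPEN pinning input; the registered `stub_heightAnticoncentration`). -/
def HeightAnticoncentration : Prop :=
  ∃ C : ℝ, 0 < C ∧ ∀ s : ℕ, 1 ≤ s → ∀ h : ℤ,
    (∑' w : {w : List Step // IsIrrBridge w},
        {w : {w : List Step // IsIrrBridge w} | xEnd w.1 = s ∧ wEnd w.1 1 = h}.indicator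
          (fun w => criticalFugacity ^ w.1.length) w) ≤
      C / s * ∑' w : {w : List Step // IsIrrBridge w},
        {w : {w : List Step // IsIrrBridge w} | xEnd w.1 = s}.indicator
          (fun w => criticalFugacity ^ w.1.length) w

/-- Slab tube confinement (pinned, bridge position, lattice units; the card's core statement). -/
def SlabTubeConfinement : Prop :=
  ∀ α : ℕ, 1 ≤ α → ∃ c : ℝ, 0 < c ∧ ∀ (L W V : ℕ) (y₀ y₁ : ℤ), 1 ≤ W → W ≤ V → L ≤ α * W →
    2 * |y₀| ≤ (W : ℤ) → 2 * |y₁| ≤ (W : ℤ) →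
    ∀ N : ℕ, ∃ N' : ℕ, c * slabTubeMass L V y₀ y₁ N ≤ slabTubeMass L W y₀ y₁ N'

/-- Two-sided slab tube confinement (v4): `SlabTubeConfinement` restricted to boxes of bounded aspect BOTH ways
(`L ≤ αW ∧ W ≤ α(L+1)`) — what the junction consumes. -/
def SlabTubeConfinement' : Prop :=
  ∀ α : ℕ, 1 ≤ α → ∃ c : ℝ, 0 < c ∧ ∀ (L W V : ℕ) (y₀ y₁ : ℤ), 1 ≤ W → W ≤ V → L ≤ α * W →
    W ≤ α * (L + 1) → 2 * |y₀| ≤ (W : ℤ) → 2 * |y₁| ≤ (W : ℤ) →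
    ∀ N : ℕ, ∃ N' : ℕ, c * slabTubeMass L V y₀ y₁ N ≤ slabTubeMass L W y₀ y₁ N'

/-- LR `HeightLocalRichness` (v4, OPEN one-piece primitive, lower companion of AR; typed by the B′p1 worker): for every
aspect bound `A` and overshoot bound `1/D` there are `s₀` and `c > 0` such that the irreducible bridges of span `s ≥ s₀`
ending at ANY prescribed height `h`, `|h| ≤ As`, and overshooting the interval spanned by their endpoints by at most `s/D`,
have Kesten mass `≥ (c/s)·mass{span s}`.  (`s₀` is necessary: span-2 pieces never have `|H| ≤ 1`.) -/
def HeightLocalRichness : Prop :=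
  ∀ A D : ℕ, 1 ≤ A → 1 ≤ D → ∃ s₀ : ℕ, ∃ c : ℝ, 0 < c ∧ ∀ s : ℕ, s₀ ≤ s → ∀ h : ℤ, |h| ≤ ((A * s : ℕ) : ℤ) →
    c / s * (∑' w : {w : List Step // IsIrrBridge w},
        {w : {w : List Step // IsIrrBridge w} | xEnd w.1 = s}.indicator
          (fun w => criticalFugacity ^ w.1.length) w) ≤
      ∑' w : {w : List Step // IsIrrBridge w},
        {w : {w : List Step // IsIrrBridge w} | xEnd w.1 = s ∧ wEnd w.1 1 = h ∧
            ∀ i, (D : ℤ) * min h 0 - (s : ℤ) ≤ (D : ℤ) * traj w.1 i 1 ∧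
              (D : ℤ) * traj w.1 i 1 ≤ (D : ℤ) * max h 0 + (s : ℤ)}.indicator
          (fun w => criticalFugacity ^ w.1.length) w

/-- USP `SmallPiecesCeiling` (v4, OPEN span-law primitive, upper companion of S): among Kesten chains of total span `n`,
those ALL of whose pieces have span `< n/K` carry a fraction `≤ C/K²` of the critical mass (for SAW the heuristic is
`exp(−c K^{3/4})`; the all-unit chains force `C ≈ 30`). -/
def SmallPiecesCeiling : Prop :=
  ∃ C : ℝ, 0 < C ∧ ∀ K n : ℕ, 1 ≤ K →
    (K : ℝ≥0∞) ^ 2 * chainSpanMass n (fun l => ∀ w ∈ l, (K : ℤ) * xEnd w < (n : ℤ)) ≤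
      ENNReal.ofReal C * chainSpanMass n (fun _ => True)

/-- Den output (v4): chain-level end-height anti-concentration — the end height of a Kesten chain of span `n ≥ 1` has
atoms `≤ (C/n)·u_n`. -/
def PinnedAtomCeiling : Prop :=
  ∃ C : ℝ, 0 < C ∧ ∀ n : ℕ, 1 ≤ n → ∀ h : ℤ,
    chainSpanMass n (fun l => wEnd l.flatten 1 = h) ≤ ENNReal.ofReal (C / n) * chainSpanMass n (fun _ => True)

/-- Num output (v4): chain-level pinned tube floor — for `W ≥ W₀(α)`, two-sided aspect and `|y₀|, |y₁| ≤ W/2`, the chains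
of span `L+1` started at height `y₀` that END at `y₁` and stay in `|y| ≤ W` carry mass `≥ (c/(L+1))·u_{L+1}`. -/
def PinnedTubeFloor : Prop :=
  ∀ α : ℕ, 1 ≤ α → ∃ c : ℝ, 0 < c ∧ ∃ W₀ : ℕ, ∀ (L W : ℕ) (y₀ y₁ : ℤ), W₀ ≤ W → L ≤ α * W →
    W ≤ α * (L + 1) → 2 * |y₀| ≤ (W : ℤ) → 2 * |y₁| ≤ (W : ℤ) →
    ENNReal.ofReal (c / (L + 1 : ℕ)) * chainSpanMass (L + 1) (fun _ => True) ≤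
      chainSpanMass (L + 1) (fun l => y₀ + wEnd l.flatten 1 = y₁ ∧ ∀ i, |y₀ + traj l.flatten i 1| ≤ (W : ℤ))

/-- SPC, the standard-pair statement (T-report-c1 §2): for every Dobrushin domain with an endpoint approximation, a
radius `L` with `closure Ω ⊆ B(0,L/2)` and a plug radius `0 < r ≤ |a-b|/8`, the critical SAW of the socketed disc
`Ω ∪ (B(0,L) ∖ (B̄(a,r) ∪ B̄(b,r)))` is, with probability `≥ c > 0` for small `δ`, an `Ω_δ`-walk all of whose vertices
lie in the doubled socket balls or in some finite `δ`-independent complex of closed rectangles inside `Ω`. -/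
def StandardPairConfinement : Prop :=
  ∀ (D : DobrushinDomain) (a b : ℝ → Site 2), SAW.IsEndpointApprox D a b →
    ∀ (L r : ℝ), closure D.carrier ⊆ Metric.ball (0 : ℂ) (L / 2) → 0 < r →
      8 * r ≤ dist (D.pt 0) (D.pt 1) →
      ∃ (B : Finset (ℂ × ℂ)) (c δ₀ : ℝ), (∀ p ∈ B, Complex.Rectangle p.1 p.2 ⊆ D.carrier) ∧
        0 < c ∧ 0 < δ₀ ∧ ∀ δ ∈ Set.Ioc (0 : ℝ) δ₀,
        ENNReal.ofReal c ≤
          SAW.law (D.carrier ∪ (Metric.ball (0 : ℂ) L \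
              (Metric.closedBall (D.pt 0) r ∪ Metric.closedBall (D.pt 1) r))) δ (a δ) (b δ)
            {γ | ∃ γ' : SAW.DomainSAW D.carrier δ (a δ) (b δ),
              γ'.walk.support = γ.walk.support ∧
              ∀ v ∈ γ'.walk.support,
                meshPoint δ v ∈ Metric.ball (D.pt 0) (2 * r) ∪ Metric.ball (D.pt 1) (2 * r) ∨
                ∃ p ∈ B, meshPoint δ v ∈ Complex.Rectangle p.1 p.2}

/-- SlabPairConfinement (conclusion of the landed `stub_slabPairReduction` p151594 / `stub_slabPairReduction2` p167861): the
crux RESTRICTED to box pairs `D = (0,L)×(-V,V) ⊇ D' = (0,L)×(-W,W)`, marked points `0, L`, endpoint approximations in the extremal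
columns of `D_δ`. -/
def SlabPairConfinement : Prop :=
  ∀ (D D' : DobrushinDomain) (a b : ℝ → Site 2) (d L V W : ℝ), 0 < L → 0 < W → W ≤ V →
    D.carrier = (Set.Ioo (0 : ℝ) L ×ℂ Set.Ioo (-V) V) →
    D'.carrier = (Set.Ioo (0 : ℝ) L ×ℂ Set.Ioo (-W) W) → D.pt 0 = 0 → D.pt 1 = (L : ℂ) →
    0 < d → D'.carrier ⊆ D.carrier → D'.pt 0 = D.pt 0 → D'.pt 1 = D.pt 1 →
    D.carrier ∩ (Metric.ball (D.pt 0) d ∪ Metric.ball (D.pt 1) d) ⊆ D'.carrier →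
    SAW.IsEndpointApprox D' a b →
    (∀ᶠ δ in 𝓝[>] (0 : ℝ), ∀ x ∈ meshVertices D.carrier δ, (a δ) 0 ≤ x 0 ∧ x 0 ≤ (b δ) 0) →
    ∃ c δ₀ : ℝ, 0 < c ∧ 0 < δ₀ ∧ ∀ δ ∈ Set.Ioc (0 : ℝ) δ₀,
      ENNReal.ofReal c ≤ SAW.law D.carrier δ (a δ) (b δ)
        {γ | ∃ γ' : SAW.DomainSAW D'.carrier δ (a δ) (b δ), γ'.walk.support = γ.walk.support}

/-! ### Registered names of the stub statements -/
namespace Registered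

/-- P, under the name of its stub (UAT-exp ∧ AR). -/
abbrev stub_pinningPrimitives : Prop := ExtentExpTail ∧ HeightAnticoncentration
/-- R (v4), under the name of its stub (S ∧ USP ∧ LR). -/
abbrev stub_regularityPrimitives : Prop := SmallPiecesFloor ∧ SmallPiecesCeiling ∧ HeightLocalRichness
/-- Den (v4), under the name of its stub. -/
abbrev stub_pinnedDenominator : Prop := HeightAnticoncentration → SmallPiecesCeiling → PinnedAtomCeiling
/-- Num (v4), under the name of its stub. -/
abbrev stub_pinnedNumerator : Prop := UnpinnedSlabTube → HeightLocalRichness → SmallPiecesCeiling → PinnedTubeFloor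
/-- Asm (v4), under the name of its stub. -/
abbrev stub_pinnedAssembly : Prop := PinnedAtomCeiling → PinnedTubeFloor → SlabTubeConfinement'
/-- J2 (v4), under the name of its stub (two-sided input). -/
abbrev stub_junction2 : Prop := SlabTubeConfinement' → StandardPairConfinement
/-- UE (LANDED p154815). -/
abbrev stub_extentSecondMoment_of_expTail : Prop := ExtentExpTail → ExtentSecondMoment
/-- B′u (LANDED p151705). -/
abbrev stub_unpinnedSlabTube : Prop := ExtentSecondMoment → SmallPiecesFloor → UnpinnedSlabTube
/-- T2 (LANDED p149604). -/
abbrev stub_standardPairReduction : Prop := StandardPairConfinement → ConfinementPositivity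
/-- Two-sided slab pair (LANDED p167861, cycle 3). -/
abbrev stub_slabPairReduction2 : Prop := SlabTubeConfinement' → SlabPairConfinement

end Registered

/-! ### Composition (glue only; the FIRST theorem of the file concluding the crux) -/

/-- The crux from the three OPEN stubs P, R (primitives of Kesten's measure) and J2 (the junction); the landed stubs UE
(`Theorems.stub_extentSecondMoment_of_expTail`, p154815), B′u (`Theorems.stub_unpinnedSlabTube`, p151705), Den
(`Theorems.stub_pinnedDenominator`, p160861), Num (`Theorems.stub_pinnedNumerator`, p163106), Asm (`Theorems.stub_pinnedAssembly`,
p163906) and T2 (`Theorems.stub_standardPairReduction`, p149604) are discharged inside the proof. -/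
theorem ConfinementPositivity_of (hP : Registered.stub_pinningPrimitives) (hR : Registered.stub_regularityPrimitives)
    (hJ : Registered.stub_junction2) : ConfinementPositivity :=
  Theorems.stub_standardPairReduction
    (hJ (Theorems.stub_pinnedAssembly (Theorems.stub_pinnedDenominator hP.2 hR.2.1)
      (Theorems.stub_pinnedNumerator
        (Theorems.stub_unpinnedSlabTube (Theorems.stub_extentSecondMoment_of_expTail hP.1) hR.1) hR.2.2 hR.2.1)))

/-! ### The stubs (the ONLY `sorry`s of this file); every signature is written out over tree vocabulary -/

/-- STUB P `stub_pinningPrimitives` (OPEN: UAT-exp ∧ AR). -/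
theorem stub_pinningPrimitives :
    (∃ C : ℝ, 0 < C ∧ ∀ s t : ℕ, 1 ≤ s → 1 ≤ t →
      (∑' w : {w : List Step // IsIrrBridge w},
          {w : {w : List Step // IsIrrBridge w} | xEnd w.1 = s ∧
              t * s ≤ (Finset.range (w.1.length + 1)).sup fun i => (traj w.1 i 1).natAbs}.indicator
            (fun w => criticalFugacity ^ w.1.length) w) ≤
        C * Real.exp (-(t : ℝ) / C) * ∑' w : {w : List Step // IsIrrBridge w},
          {w : {w : List Step // IsIrrBridge w} | xEnd w.1 = s}.indicator
            (fun w => criticalFugacity ^ w.1.length) w) ∧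
    (∃ C : ℝ, 0 < C ∧ ∀ s : ℕ, 1 ≤ s → ∀ h : ℤ,
      (∑' w : {w : List Step // IsIrrBridge w},
          {w : {w : List Step // IsIrrBridge w} | xEnd w.1 = s ∧ wEnd w.1 1 = h}.indicator
            (fun w => criticalFugacity ^ w.1.length) w) ≤
        C / s * ∑' w : {w : List Step // IsIrrBridge w},
          {w : {w : List Step // IsIrrBridge w} | xEnd w.1 = s}.indicator
            (fun w => criticalFugacity ^ w.1.length) w) := by
  sorry

/-- STUB R `stub_regularityPrimitives` (v4, OPEN: S `SmallPiecesFloor` ∧ USP `SmallPiecesCeiling` ∧ LR `HeightLocalRichness`). -/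
theorem stub_regularityPrimitives :
    (∀ a b : ℕ, 1 ≤ a → 1 ≤ b → ∃ q : ℝ, 0 < q ∧ ∀ W L : ℕ, b ≤ W → L ≤ a * W →
      ENNReal.ofReal q *
          (∑' l : {l : List (List Step) // (∀ w ∈ l, IsIrrBridge w) ∧ (l.map xEnd).sum = (L : ℤ) ∧ True},
            ENNReal.ofReal (criticalFugacity ^ (l.1.map List.length).sum)) ≤
        ∑' l : {l : List (List Step) // (∀ w ∈ l, IsIrrBridge w) ∧ (l.map xEnd).sum = (L : ℤ) ∧
            ∀ w ∈ l, (b : ℤ) * xEnd w ≤ (W : ℤ)},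
          ENNReal.ofReal (criticalFugacity ^ (l.1.map List.length).sum)) ∧
    (∃ C : ℝ, 0 < C ∧ ∀ K n : ℕ, 1 ≤ K →
      (K : ℝ≥0∞) ^ 2 *
          (∑' l : {l : List (List Step) // (∀ w ∈ l, IsIrrBridge w) ∧ (l.map xEnd).sum = (n : ℤ) ∧
              ∀ w ∈ l, (K : ℤ) * xEnd w < (n : ℤ)},
            ENNReal.ofReal (criticalFugacity ^ (l.1.map List.length).sum)) ≤
        ENNReal.ofReal C *
          ∑' l : {l : List (List Step) // (∀ w ∈ l, IsIrrBridge w) ∧ (l.map xEnd).sum = (n : ℤ) ∧ True},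
            ENNReal.ofReal (criticalFugacity ^ (l.1.map List.length).sum)) ∧
    (∀ A D : ℕ, 1 ≤ A → 1 ≤ D → ∃ s₀ : ℕ, ∃ c : ℝ, 0 < c ∧ ∀ s : ℕ, s₀ ≤ s → ∀ h : ℤ, |h| ≤ ((A * s : ℕ) : ℤ) →
      c / s * (∑' w : {w : List Step // IsIrrBridge w},
          {w : {w : List Step // IsIrrBridge w} | xEnd w.1 = s}.indicator
            (fun w => criticalFugacity ^ w.1.length) w) ≤
        ∑' w : {w : List Step // IsIrrBridge w},
          {w : {w : List Step // IsIrrBridge w} | xEnd w.1 = s ∧ wEnd w.1 1 = h ∧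
              ∀ i, (D : ℤ) * min h 0 - (s : ℤ) ≤ (D : ℤ) * traj w.1 i 1 ∧
                (D : ℤ) * traj w.1 i 1 ≤ (D : ℤ) * max h 0 + (s : ℤ)}.indicator
            (fun w => criticalFugacity ^ w.1.length) w) := by
  sorry

/-- STUB Den `stub_pinnedDenominator` — LANDED p160861 (`Theorems/SAWRenewalTightnessConfinementPositivityPinnedDenominator.lean`).  ORIGINAL PLAN:
with `K = 1`): for a chain of span `n` and `j ≥ 0` let `D_j` = {all pieces of span `< n/2^j`, some piece `≥ n/2^{j+1}`}
(plus the one-piece chain); cut at the FIRST piece of span `≥ n/2^{j+1}`; given prefix and suffix, AR bounds the mass of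
the cut piece with the one height that pins the end by `(C/s)·mass{span s} ≤ (C 2^{j+1}/n)·mass{span s}`; re-inserting an
arbitrary piece of span `s` recovers `mass(D_j) ≤ C_U u_n / 4^j` (USP with `K = 2^j`); sum over `j`. -/
theorem stub_pinnedDenominator :
    (∃ C : ℝ, 0 < C ∧ ∀ s : ℕ, 1 ≤ s → ∀ h : ℤ,
      (∑' w : {w : List Step // IsIrrBridge w},
          {w : {w : List Step // IsIrrBridge w} | xEnd w.1 = s ∧ wEnd w.1 1 = h}.indicator
            (fun w => criticalFugacity ^ w.1.length) w) ≤
        C / s * ∑' w : {w : List Step // IsIrrBridge w},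
          {w : {w : List Step // IsIrrBridge w} | xEnd w.1 = s}.indicator
            (fun w => criticalFugacity ^ w.1.length) w) →
    (∃ C : ℝ, 0 < C ∧ ∀ K n : ℕ, 1 ≤ K →
      (K : ℝ≥0∞) ^ 2 *
          (∑' l : {l : List (List Step) // (∀ w ∈ l, IsIrrBridge w) ∧ (l.map xEnd).sum = (n : ℤ) ∧
              ∀ w ∈ l, (K : ℤ) * xEnd w < (n : ℤ)},
            ENNReal.ofReal (criticalFugacity ^ (l.1.map List.length).sum)) ≤
        ENNReal.ofReal C *
          ∑' l : {l : List (List Step) // (∀ w ∈ l, IsIrrBridge w) ∧ (l.map xEnd).sum = (n : ℤ) ∧ True},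
            ENNReal.ofReal (criticalFugacity ^ (l.1.map List.length).sum)) →
    (∃ C : ℝ, 0 < C ∧ ∀ n : ℕ, 1 ≤ n → ∀ h : ℤ,
      (∑' l : {l : List (List Step) // (∀ w ∈ l, IsIrrBridge w) ∧ (l.map xEnd).sum = (n : ℤ) ∧
          wEnd l.flatten 1 = h},
        ENNReal.ofReal (criticalFugacity ^ (l.1.map List.length).sum)) ≤
        ENNReal.ofReal (C / n) *
          ∑' l : {l : List (List Step) // (∀ w ∈ l, IsIrrBridge w) ∧ (l.map xEnd).sum = (n : ℤ) ∧ True},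
            ENNReal.ofReal (criticalFugacity ^ (l.1.map List.length).sum)) :=
  Theorems.stub_pinnedDenominator

/-- STUB Num `stub_pinnedNumerator` — LANDED p163106 (`Theorems/…PinnedNumerator.lean`, helpers p162560 `…PinnedNumeratorLemmas.lean`, p162926 `…PinnedNumeratorSteps.lean`).  ORIGINAL PLAN:
§2.3 step 3): `n = L+1`, `Δ = y₁ − y₀`; fix `K` with `K² ≥ 2 C_U`; for each split `a + s + b = n`, `s ≥ n/K`: a prefix
chain of span `a` in the tube `⌊W/8⌋` about `y₀` (B′u at aspect `16(α+1)`, mass `≥ c₁ u_a`), a suffix of span `b` in the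
tube `⌊W/8⌋` about its own start (mass `≥ c₁ u_b`), and ONE steering piece of span `s` with height `Δ − Y_A − Y_B`
(`≤ 5W/4 ≤ 2αK·s`) and overshoot `≤ s/(8α+8) ≤ W/8` (LR, mass `≥ (c/s)·mass{span s}`); the concatenation is a chain of span
`n` from `y₀` pinned at `y₁` inside `|y| ≤ W`, each target chain arises from `≤ K` splits, and
`Σ_{s ≥ n/K} mass{span s} (u∗u)_{n−s} ≥ u_n − mass{all pieces < n/K} ≥ u_n/2` (USP); `W₀(α) = max(16, αK s₀)`. -/
theorem stub_pinnedNumerator :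
    (∀ a : ℕ, 1 ≤ a → ∃ c : ℝ, 0 < c ∧ ∀ W L : ℕ, 1 ≤ W → L ≤ a * W →
      ENNReal.ofReal c *
          (∑' l : {l : List (List Step) // (∀ w ∈ l, IsIrrBridge w) ∧ (l.map xEnd).sum = (L : ℤ) ∧ True},
            ENNReal.ofReal (criticalFugacity ^ (l.1.map List.length).sum)) ≤
        ∑' l : {l : List (List Step) // (∀ w ∈ l, IsIrrBridge w) ∧ (l.map xEnd).sum = (L : ℤ) ∧
            ∀ i, |traj l.flatten i 1| ≤ (W : ℤ)},
          ENNReal.ofReal (criticalFugacity ^ (l.1.map List.length).sum)) →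
    (∀ A D : ℕ, 1 ≤ A → 1 ≤ D → ∃ s₀ : ℕ, ∃ c : ℝ, 0 < c ∧ ∀ s : ℕ, s₀ ≤ s → ∀ h : ℤ, |h| ≤ ((A * s : ℕ) : ℤ) →
      c / s * (∑' w : {w : List Step // IsIrrBridge w},
          {w : {w : List Step // IsIrrBridge w} | xEnd w.1 = s}.indicator
            (fun w => criticalFugacity ^ w.1.length) w) ≤
        ∑' w : {w : List Step // IsIrrBridge w},
          {w : {w : List Step // IsIrrBridge w} | xEnd w.1 = s ∧ wEnd w.1 1 = h ∧
              ∀ i, (D : ℤ) * min h 0 - (s : ℤ) ≤ (D : ℤ) * traj w.1 i 1 ∧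
                (D : ℤ) * traj w.1 i 1 ≤ (D : ℤ) * max h 0 + (s : ℤ)}.indicator
            (fun w => criticalFugacity ^ w.1.length) w) →
    (∃ C : ℝ, 0 < C ∧ ∀ K n : ℕ, 1 ≤ K →
      (K : ℝ≥0∞) ^ 2 *
          (∑' l : {l : List (List Step) // (∀ w ∈ l, IsIrrBridge w) ∧ (l.map xEnd).sum = (n : ℤ) ∧
              ∀ w ∈ l, (K : ℤ) * xEnd w < (n : ℤ)},
            ENNReal.ofReal (criticalFugacity ^ (l.1.map List.length).sum)) ≤
        ENNReal.ofReal C *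
          ∑' l : {l : List (List Step) // (∀ w ∈ l, IsIrrBridge w) ∧ (l.map xEnd).sum = (n : ℤ) ∧ True},
            ENNReal.ofReal (criticalFugacity ^ (l.1.map List.length).sum)) →
    (∀ α : ℕ, 1 ≤ α → ∃ c : ℝ, 0 < c ∧ ∃ W₀ : ℕ, ∀ (L W : ℕ) (y₀ y₁ : ℤ), W₀ ≤ W → L ≤ α * W →
      W ≤ α * (L + 1) → 2 * |y₀| ≤ (W : ℤ) → 2 * |y₁| ≤ (W : ℤ) →
      ENNReal.ofReal (c / (L + 1 : ℕ)) *
          (∑' l : {l : List (List Step) // (∀ w ∈ l, IsIrrBridge w) ∧ (l.map xEnd).sum = ((L + 1 : ℕ) : ℤ) ∧ True},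
            ENNReal.ofReal (criticalFugacity ^ (l.1.map List.length).sum)) ≤
        ∑' l : {l : List (List Step) // (∀ w ∈ l, IsIrrBridge w) ∧ (l.map xEnd).sum = ((L + 1 : ℕ) : ℤ) ∧
            (y₀ + wEnd l.flatten 1 = y₁ ∧ ∀ i, |y₀ + traj l.flatten i 1| ≤ (W : ℤ))},
          ENNReal.ofReal (criticalFugacity ^ (l.1.map List.length).sum)) :=
  Theorems.stub_pinnedNumerator

/-- STUB Asm `stub_pinnedAssembly` — LANDED p163906 (`Theorems/…PinnedAssembly.lean`).  ORIGINAL PLAN: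
`W ≥ W₀`: V-side `≤` pinned mass without tube `≤ (C/n) u_n` (monotonicity of `chainSpanMass` in the predicate), W-side
`≥ (c/n) u_n`, ratio `c/C`; `W < W₀`: W-side `≥ x_c^{n+|Δ|}` (the chain `[E·N^{Δ}, E, …, E]`, resp. `E·S^{|Δ|}`), V-side
`≤ u_n ≤ 1` (bridge mass, `StripMass.bridgeWordMass_le_one` through the landed chain ↔ word bijection, or `≤ n + 1` by
`UnpinnedSlabTube.tsum_tsum_span_le`), `n + |Δ| ≤ (α+1) W₀ + 1`; then chain → slab currency pointwise by the landed
`SlabOfChain.chain_eq_ofReal_slab` / `slab_mono` (`N' = (L+2)(2W+1)`). -/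
theorem stub_pinnedAssembly :
    (∃ C : ℝ, 0 < C ∧ ∀ n : ℕ, 1 ≤ n → ∀ h : ℤ,
      (∑' l : {l : List (List Step) // (∀ w ∈ l, IsIrrBridge w) ∧ (l.map xEnd).sum = (n : ℤ) ∧
          wEnd l.flatten 1 = h},
        ENNReal.ofReal (criticalFugacity ^ (l.1.map List.length).sum)) ≤
        ENNReal.ofReal (C / n) *
          ∑' l : {l : List (List Step) // (∀ w ∈ l, IsIrrBridge w) ∧ (l.map xEnd).sum = (n : ℤ) ∧ True},
            ENNReal.ofReal (criticalFugacity ^ (l.1.map List.length).sum)) →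
    (∀ α : ℕ, 1 ≤ α → ∃ c : ℝ, 0 < c ∧ ∃ W₀ : ℕ, ∀ (L W : ℕ) (y₀ y₁ : ℤ), W₀ ≤ W → L ≤ α * W →
      W ≤ α * (L + 1) → 2 * |y₀| ≤ (W : ℤ) → 2 * |y₁| ≤ (W : ℤ) →
      ENNReal.ofReal (c / (L + 1 : ℕ)) *
          (∑' l : {l : List (List Step) // (∀ w ∈ l, IsIrrBridge w) ∧ (l.map xEnd).sum = ((L + 1 : ℕ) : ℤ) ∧ True},
            ENNReal.ofReal (criticalFugacity ^ (l.1.map List.length).sum)) ≤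
        ∑' l : {l : List (List Step) // (∀ w ∈ l, IsIrrBridge w) ∧ (l.map xEnd).sum = ((L + 1 : ℕ) : ℤ) ∧
            (y₀ + wEnd l.flatten 1 = y₁ ∧ ∀ i, |y₀ + traj l.flatten i 1| ≤ (W : ℤ))},
          ENNReal.ofReal (criticalFugacity ^ (l.1.map List.length).sum)) →
    (∀ α : ℕ, 1 ≤ α → ∃ c : ℝ, 0 < c ∧ ∀ (L W V : ℕ) (y₀ y₁ : ℤ), 1 ≤ W → W ≤ V → L ≤ α * W →
      W ≤ α * (L + 1) → 2 * |y₀| ≤ (W : ℤ) → 2 * |y₁| ≤ (W : ℤ) → ∀ N : ℕ, ∃ N' : ℕ,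
        c * (∑ n ∈ Finset.range (N + 1), ∑ _ω ∈ (Zd.sawFun 2 n ![(L : ℤ), y₁ - y₀]).filter
            (fun ω => ∀ i ≤ n, (0 : ℤ) ≤ ω i 0 ∧ ω i 0 ≤ (L : ℤ) ∧ |y₀ + ω i 1| ≤ (V : ℤ)), criticalFugacity ^ n) ≤
          (∑ n ∈ Finset.range (N' + 1), ∑ _ω ∈ (Zd.sawFun 2 n ![(L : ℤ), y₁ - y₀]).filter
            (fun ω => ∀ i ≤ n, (0 : ℤ) ≤ ω i 0 ∧ ω i 0 ≤ (L : ℤ) ∧ |y₀ + ω i 1| ≤ (W : ℤ)), criticalFugacity ^ n)) :=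
  Theorems.stub_pinnedAssembly

/-- STUB J2 `stub_junction2` (v4; research-open junction, crux-sized — `LeadAnalysis-c2.md` §4): two-sided slab tube
confinement → SPC. -/
theorem stub_junction2 :
    (∀ α : ℕ, 1 ≤ α → ∃ c : ℝ, 0 < c ∧ ∀ (L W V : ℕ) (y₀ y₁ : ℤ), 1 ≤ W → W ≤ V → L ≤ α * W →
      W ≤ α * (L + 1) → 2 * |y₀| ≤ (W : ℤ) → 2 * |y₁| ≤ (W : ℤ) → ∀ N : ℕ, ∃ N' : ℕ,
        c * (∑ n ∈ Finset.range (N + 1), ∑ _ω ∈ (Zd.sawFun 2 n ![(L : ℤ), y₁ - y₀]).filter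
            (fun ω => ∀ i ≤ n, (0 : ℤ) ≤ ω i 0 ∧ ω i 0 ≤ (L : ℤ) ∧ |y₀ + ω i 1| ≤ (V : ℤ)), criticalFugacity ^ n) ≤
          (∑ n ∈ Finset.range (N' + 1), ∑ _ω ∈ (Zd.sawFun 2 n ![(L : ℤ), y₁ - y₀]).filter
            (fun ω => ∀ i ≤ n, (0 : ℤ) ≤ ω i 0 ∧ ω i 0 ≤ (L : ℤ) ∧ |y₀ + ω i 1| ≤ (W : ℤ)), criticalFugacity ^ n)) →
    (∀ (D : DobrushinDomain) (a b : ℝ → Site 2), SAW.IsEndpointApprox D a b →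
      ∀ (L r : ℝ), closure D.carrier ⊆ Metric.ball (0 : ℂ) (L / 2) → 0 < r →
        8 * r ≤ dist (D.pt 0) (D.pt 1) →
        ∃ (B : Finset (ℂ × ℂ)) (c δ₀ : ℝ), (∀ p ∈ B, Complex.Rectangle p.1 p.2 ⊆ D.carrier) ∧
          0 < c ∧ 0 < δ₀ ∧ ∀ δ ∈ Set.Ioc (0 : ℝ) δ₀,
          ENNReal.ofReal c ≤
            SAW.law (D.carrier ∪ (Metric.ball (0 : ℂ) L \
                (Metric.closedBall (D.pt 0) r ∪ Metric.closedBall (D.pt 1) r))) δ (a δ) (b δ)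
              {γ | ∃ γ' : SAW.DomainSAW D.carrier δ (a δ) (b δ),
                γ'.walk.support = γ.walk.support ∧
                ∀ v ∈ γ'.walk.support,
                  meshPoint δ v ∈ Metric.ball (D.pt 0) (2 * r) ∪ Metric.ball (D.pt 1) (2 * r) ∨
                  ∃ p ∈ B, meshPoint δ v ∈ Complex.Rectangle p.1 p.2}) := by
  sorry

/-- UE `stub_extentSecondMoment_of_expTail` — LANDED p154815 (`Theorems/SAWRenewalTightnessConfinementPositivityExtentOfExpTail.lean`). -/
theorem stub_extentSecondMoment_of_expTail : Registered.stub_extentSecondMoment_of_expTail :=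
  Theorems.stub_extentSecondMoment_of_expTail

/-- B′u `stub_unpinnedSlabTube` — LANDED p151705 (`Theorems/SAWRenewalTightnessConfinementPositivityUnpinnedSlabTube.lean`). -/
theorem stub_unpinnedSlabTube : Registered.stub_unpinnedSlabTube :=
  Theorems.stub_unpinnedSlabTube

/-- T2 `stub_standardPairReduction` — LANDED p149604 (`Theorems/SAWRenewalTightnessConfinementPositivityStandardPair.lean`). -/
theorem stub_standardPairReduction : Registered.stub_standardPairReduction :=
  Theorems.stub_standardPairReduction

/-- B′p0 `stub_slabOfChain` — LANDED p156756 (one-sided currency change; its pointwise core `SlabOfChain.chain_eq_ofReal_slab`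
is what Asm reuses). -/
theorem slabOfChain_landed : (∀ α : ℕ, 1 ≤ α → ∃ c : ℝ, 0 < c ∧ ∀ (L W V : ℕ) (y₀ y₁ : ℤ), 1 ≤ W → W ≤ V → L ≤ α * W →
      2 * |y₀| ≤ (W : ℤ) → 2 * |y₁| ≤ (W : ℤ) →
      ENNReal.ofReal c *
        chainSpanMass (L + 1) (fun l => y₀ + wEnd l.flatten 1 = y₁ ∧ ∀ i, |y₀ + traj l.flatten i 1| ≤ (V : ℤ)) ≤
      chainSpanMass (L + 1) (fun l => y₀ + wEnd l.flatten 1 = y₁ ∧ ∀ i, |y₀ + traj l.flatten i 1| ≤ (W : ℤ))) →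
    SlabTubeConfinement :=
  Theorems.stub_slabOfChain

/-! ### Unfolding lemmas: the written-out stub signatures are the named statements -/

theorem pinningPrimitives_holds : ExtentExpTail ∧ HeightAnticoncentration := stub_pinningPrimitives

theorem regularityPrimitives_holds : SmallPiecesFloor ∧ SmallPiecesCeiling ∧ HeightLocalRichness :=
  stub_regularityPrimitives

theorem pinnedDenominator_of : HeightAnticoncentration → SmallPiecesCeiling → PinnedAtomCeiling := stub_pinnedDenominator

theorem pinnedNumerator_of : UnpinnedSlabTube → HeightLocalRichness → SmallPiecesCeiling → PinnedTubeFloor :=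
  stub_pinnedNumerator

theorem pinnedAssembly_of : PinnedAtomCeiling → PinnedTubeFloor → SlabTubeConfinement' := stub_pinnedAssembly

theorem junction2_of : SlabTubeConfinement' → StandardPairConfinement := stub_junction2

/-- U2 follows from P (landed UE). -/
theorem extentSecondMoment_holds : ExtentSecondMoment :=
  Theorems.stub_extentSecondMoment_of_expTail pinningPrimitives_holds.1

/-- The unpinned slab tube follows from P and R (landed UE, B′u). -/
theorem unpinnedSlabTube_holds : UnpinnedSlabTube :=
  Theorems.stub_unpinnedSlabTube extentSecondMoment_holds regularityPrimitives_holds.1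

/-- The lattice core of the line, modulo its stubs: two-sided slab tube confinement. -/
theorem slabTubeConfinement'_holds : SlabTubeConfinement' :=
  pinnedAssembly_of (pinnedDenominator_of pinningPrimitives_holds.2 regularityPrimitives_holds.2.1)
    (pinnedNumerator_of unpinnedSlabTube_holds regularityPrimitives_holds.2.2 regularityPrimitives_holds.2.1)

/-- R1 is no longer a stub: the landed theorem, re-exported in the line's vocabulary. -/
theorem rademacherTube_landed :
    ∃ C : ℕ, 0 < C ∧ ∀ (n r K : ℕ) (h : Fin n → ℕ), 1 ≤ r →
      (∀ i, 2 * h i ≤ r) → (∑ i, h i ^ 2) ≤ K * r ^ 2 →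
        2 ^ n ≤ C ^ (K + 1) *
          ((Finset.univ : Finset (Fin n → Bool)).filter
            (fun σ => ∀ k ≤ n, |∑ i : Fin n, (if (i : ℕ) < k then
              (if σ i then (h i : ℤ) else -(h i : ℤ)) else 0)| ≤ (r : ℤ))).card :=
  Theorems.stub_rademacherTube

/-- Two-sided slab pair `stub_slabPairReduction2` — LANDED p167861 (`Theorems/…ConfinementPositivitySlabPairTwoSided.lean`, cycle 3). -/
theorem stub_slabPairReduction2 : Registered.stub_slabPairReduction2 :=
  Theorems.stub_slabPairReduction2

/-- **The crux on box pairs, modulo P and R** (cycle 3): `SlabPairConfinement` from the two OPEN primitive stubs through the landed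
chain UE → B′u → Den/Num → Asm → slabPair2 (tree name of the unconditional-in-form composite:
`Theorems.boxPairConfinement_of_kestenPrimitives`, p167861). -/
theorem slabPairConfinement_holds : SlabPairConfinement :=
  stub_slabPairReduction2 slabTubeConfinement'_holds

/-! ### The crux modulo the stubs (wiring check) -/

/-- The crux, modulo the stubs. -/
theorem ConfinementPositivity_proof : ConfinementPositivity :=
  ConfinementPositivity_of pinningPrimitives_holds regularityPrimitives_holds junction2_of

end Summit.CriticalPhenomena.SAWScalingLimit.Cruxes.ConfinementPositivity.SignUniversality
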